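import Summits.Ventures.HodgeRepro2.T5SU11AffineAction
import Summits.Ventures.HodgeRepro2.T5SU11HorocycleTransitive

/-!
# The Iwasawa projections `g ↦ (s(g), t(g), k(g))` in closed form: `e^{2 t(g)} = P(g·0) = |a - b̄|^{-2}`

Every `g ∈ SU(1,1)` is uniquely `n_s a_t k` (`T5SU11Iwasawa`, `T5SU11IwasawaUnique`); this file gives
the three components as EXPLICIT FUNCTIONS of `g`: with `w = (1 + g·0)/(1 - g·0)` the half-plane
coordinate of the orbit point (`T5SU11HorocycleTransitive.half`), `s(g) = -Im w / 2`,
`t(g) = (log Re w) / 2` (`iwasawaS`, `iwasawaT`; `half ((n_s a_t)·0) = e^{2t} - 2is`,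
`half_iwasawaOrbit`) and `k(g) = kProj (n_{s(g)} a_{t(g)})⁻¹ · kProj g` (`iwasawaK`, with the
`K`-projection of `T5SU11KProjection`), so that **`g = n_{s(g)} a_{t(g)} · rot (k(g))`**
(`eq_iwasawa_decomposition`) and the projections invert the Iwasawa map (`iwasawaS_iwasawa`,
`iwasawaT_iwasawa`, `iwasawaK_iwasawa`). The `A`-component is the POISSON KERNEL of the orbit point:
**`e^{2 t(g)} = P(g·0) = (1 - |g·0|²)/|1 - g·0|²`** (`exp_two_mul_iwasawaT`), i.e.
**`e^{t(g)} = |a - b̄|^{-1}`** for `g = su11 a b` (`exp_iwasawaT`) — the `SU(1,1)` form of the classical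
`a(g) = |c i + d|^{-1}`. Equivariance: `s, t` are right-`K`-invariant and `k(g · rot u) = k(g) · u`
(`iwasawaS_mul_rot`, `iwasawaT_mul_rot`, `iwasawaK_mul_rot`); `s(n_σ g) = s(g) + σ`,
`t(n_σ g) = t(g)`, `t(a_τ g) = t(g) + τ`, `s(a_τ g) = e^{2τ} s(g)` (`iwasawaS_unip_mul`, …). Nothing is
claimed about (N).

Blind lane: Mathlib + the HodgeRepro2 prefix only; no sorry; axioms ⊆ {propext, Classical.choice,
Quot.sound}.
-/

namespace Summit.Ventures.HodgeRepro2.T5SU11IwasawaProjection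

open Metric Set Complex
open T5PoincareDensity T5PoincareInvariance T5SU11Unimodular T5SU11Fibration T5SU11Cartan
  T5SU11OneParameter T5BergmanCoefficient T5SU11UnipotentSubgroup T5SU11HyperbolicSubgroup
  T5SU11Iwasawa T5SU11IwasawaUnique T5SU11IwasawaHaar T5SU11IwasawaMeasure T5SU11BorelHaarNA
  T5SU11FibrationCocycle T5SU11KProjection T5SU11AffineAction T5SU11Horocycle
  T5SU11HorocycleTransitive

/-! ### The half-plane coordinate of the Iwasawa orbit -/

/-- `half ((n_s a_t)·0) = e^{2t} - 2is`. -/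
theorem half_iwasawaOrbit (ζ : ℂ) : half (iwasawaOrbit ζ) = iwasawaHalf ζ := by
  rw [iwasawaOrbit_eq]
  unfold half cayleyDisc
  have h : iwasawaHalf ζ + 1 ≠ 0 := iwasawaHalf_add_one_ne_zero ζ
  field_simp
  ring

/-- `half (Ψ(ζ, k)·0) = e^{2t} - 2is`. -/
theorem half_orbit_iwasawa (ζ : ℂ) (u : Circle) : half (orbit (iwasawa (ζ, u))) = iwasawaHalf ζ := by
  rw [orbit_iwasawa]
  exact half_iwasawaOrbit ζ

/-! ### The Iwasawa projections -/

/-- The `N`-parameter of `g`: `s(g) = -Im w / 2`, `w = (1 + g·0)/(1 - g·0)`. -/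
noncomputable def iwasawaS (g : SU11) : ℝ := -(half (orbit g)).im / 2

/-- The `A`-parameter of `g`: `t(g) = (log Re w) / 2`, `w = (1 + g·0)/(1 - g·0)`. -/
noncomputable def iwasawaT (g : SU11) : ℝ := Real.log (half (orbit g)).re / 2

/-- The `N A`-part of `g`: `n_{s(g)} a_{t(g)}`. -/
noncomputable def iwasawaNA (g : SU11) : SU11 := borelCoordNA ⟨iwasawaS g, iwasawaT g⟩

/-- The `K`-parameter of `g`: `k(g) = kProj (n_{s(g)} a_{t(g)})⁻¹ · kProj g`. -/
noncomputable def iwasawaK (g : SU11) : Circle := (kProj (iwasawaNA g))⁻¹ * kProj g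

/-- `s(Ψ(ζ, k)) = Re ζ`. -/
theorem iwasawaS_iwasawa (ζ : ℂ) (u : Circle) : iwasawaS (iwasawa (ζ, u)) = ζ.re := by
  unfold iwasawaS
  rw [half_orbit_iwasawa, iwasawaHalf_im]
  ring

/-- `t(Ψ(ζ, k)) = Im ζ`. -/
theorem iwasawaT_iwasawa (ζ : ℂ) (u : Circle) : iwasawaT (iwasawa (ζ, u)) = ζ.im := by
  unfold iwasawaT
  rw [half_orbit_iwasawa, iwasawaHalf_re, Real.log_exp]
  ring

/-- `iwasawaNA (Ψ(ζ, k)) = n_s a_t`. -/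
theorem iwasawaNA_iwasawa (ζ : ℂ) (u : Circle) : iwasawaNA (iwasawa (ζ, u)) = borelCoordNA ζ := by
  unfold iwasawaNA
  rw [iwasawaS_iwasawa, iwasawaT_iwasawa]

/-- `k(Ψ(ζ, k)) = k`. -/
theorem iwasawaK_iwasawa (ζ : ℂ) (u : Circle) : iwasawaK (iwasawa (ζ, u)) = u := by
  unfold iwasawaK
  rw [iwasawaNA_iwasawa, kProj_iwasawa, inv_mul_cancel_left]

/-- **The explicit Iwasawa decomposition**: `g = n_{s(g)} a_{t(g)} · rot (k(g))`. -/
theorem eq_iwasawa_decomposition (g : SU11) :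
    g = unip (iwasawaS g) * hyp (iwasawaT g) * rot (iwasawaK g) := by
  obtain ⟨s, t, u, hg⟩ := exists_unip_mul_hyp_mul_rot g
  have hg' : g = iwasawa (⟨s, t⟩, u) := hg
  rw [hg', iwasawaS_iwasawa, iwasawaT_iwasawa, iwasawaK_iwasawa]
  rfl

/-- `g = iwasawaNA g · rot (k(g))`. -/
theorem eq_iwasawaNA_mul_rot (g : SU11) : g = iwasawaNA g * rot (iwasawaK g) :=
  eq_iwasawa_decomposition g

/-! ### The `A`-component is the Poisson kernel of the orbit point -/

/-- **`e^{2 t(g)} = P(g·0)`**, the Poisson kernel of the orbit point at the boundary point `1`. -/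
theorem exp_two_mul_iwasawaT (g : SU11) : Real.exp (2 * iwasawaT g) = poisson (orbit g) := by
  unfold iwasawaT
  rw [show 2 * (Real.log (half (orbit g)).re / 2) = Real.log (half (orbit g)).re by ring,
    half_re (orbit_mem_ball g), Real.exp_log (poisson_pos (orbit_mem_ball g))]

/-- **`e^{2 t(g)} = (1 - |g·0|²) / |1 - g·0|²`.** -/
theorem exp_two_mul_iwasawaT_eq (g : SU11) :
    Real.exp (2 * iwasawaT g) = (1 - ‖orbit g‖ ^ 2) / ‖1 - orbit g‖ ^ 2 := by
  rw [exp_two_mul_iwasawaT, poisson, Complex.normSq_eq_norm_sq, Complex.normSq_eq_norm_sq]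

/-- `a - b̄ ≠ 0` for `g = su11 a b` (`|a| > |b|`). -/
lemma mat_sub_conj_ne_zero (g : SU11) : mat g 0 0 - (starRingEnd ℂ) (mat g 0 1) ≠ 0 := by
  intro h
  have hab : Complex.normSq (mat g 0 0) - Complex.normSq (mat g 0 1) = 1 := normSq_sub_normSq g
  have h' : mat g 0 0 = (starRingEnd ℂ) (mat g 0 1) := sub_eq_zero.mp h
  rw [h', Complex.normSq_conj] at hab
  linarith

/-- **`e^{t(g)} = |a - b̄|^{-1}`** for `g = su11 a b`: the `A`-component of the Iwasawa decomposition
in terms of the matrix entries. -/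
theorem exp_iwasawaT (g : SU11) :
    Real.exp (iwasawaT g) = ‖mat g 0 0 - (starRingEnd ℂ) (mat g 0 1)‖⁻¹ := by
  set a := mat g 0 0 with ha
  set b := mat g 0 1 with hb
  have ha0 : a ≠ 0 := mat_zero_zero_ne_zero g
  have hab : a - (starRingEnd ℂ) b ≠ 0 := mat_sub_conj_ne_zero g
  have hsq : Real.exp (iwasawaT g) ^ 2 = (‖a - (starRingEnd ℂ) b‖⁻¹) ^ 2 := by
    rw [← Real.exp_nat_mul, Nat.cast_ofNat, exp_two_mul_iwasawaT_eq, one_sub_norm_orbit_sq,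
      orbit_eq, inv_pow, inv_pow]
    have hconj : (starRingEnd ℂ) a ≠ 0 := (map_ne_zero _).mpr ha0
    have e1 : (1 : ℂ) - b / (starRingEnd ℂ) a = ((starRingEnd ℂ) a - b) / (starRingEnd ℂ) a := by
      field_simp
    rw [e1, norm_div, Complex.norm_conj, div_pow]
    have e2 : ‖(starRingEnd ℂ) a - b‖ = ‖a - (starRingEnd ℂ) b‖ := by
      rw [← Complex.norm_conj ((starRingEnd ℂ) a - b), map_sub, Complex.conj_conj]
    rw [e2]
    have hn : ‖a‖ ^ 2 ≠ 0 := pow_ne_zero 2 (norm_ne_zero_iff.mpr ha0)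
    have hn' : ‖a - (starRingEnd ℂ) b‖ ^ 2 ≠ 0 := pow_ne_zero 2 (norm_ne_zero_iff.mpr hab)
    rw [← ha]
    field_simp
  have h1 : 0 < Real.exp (iwasawaT g) := Real.exp_pos _
  have h2 : 0 < ‖a - (starRingEnd ℂ) b‖⁻¹ := inv_pos.mpr (norm_pos_iff.mpr hab)
  exact (pow_left_inj₀ h1.le h2.le two_ne_zero).mp hsq

/-! ### Equivariance of the projections -/

/-- `s(g · rot u) = s(g)`. -/
theorem iwasawaS_mul_rot (g : SU11) (u : Circle) : iwasawaS (g * rot u) = iwasawaS g := by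
  unfold iwasawaS
  rw [orbit_mul, orbit_rot]
  rfl

/-- `t(g · rot u) = t(g)`. -/
theorem iwasawaT_mul_rot (g : SU11) (u : Circle) : iwasawaT (g * rot u) = iwasawaT g := by
  unfold iwasawaT
  rw [orbit_mul, orbit_rot]
  rfl

/-- `iwasawaNA (g · rot u) = iwasawaNA g`. -/
theorem iwasawaNA_mul_rot (g : SU11) (u : Circle) : iwasawaNA (g * rot u) = iwasawaNA g := by
  unfold iwasawaNA
  rw [iwasawaS_mul_rot, iwasawaT_mul_rot]

/-- `k(g · rot u) = k(g) · u`. -/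
theorem iwasawaK_mul_rot (g : SU11) (u : Circle) : iwasawaK (g * rot u) = iwasawaK g * u := by
  unfold iwasawaK
  rw [iwasawaNA_mul_rot, kProj_mul_rot, mul_assoc]

/-- `s(n_σ g) = s(g) + σ`. -/
theorem iwasawaS_unip_mul (σ : ℝ) (g : SU11) : iwasawaS (unip σ * g) = iwasawaS g + σ := by
  conv_lhs => rw [eq_iwasawa_decomposition g]
  rw [show unip σ * (unip (iwasawaS g) * hyp (iwasawaT g) * rot (iwasawaK g)) =
      iwasawa (⟨iwasawaS g, iwasawaT g⟩ + σ, iwasawaK g) from by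
    rw [← mul_assoc, show unip σ * (unip (iwasawaS g) * hyp (iwasawaT g)) =
      borelCoordNA (⟨iwasawaS g, iwasawaT g⟩ + σ) from unip_mul_borelCoordNA σ ⟨iwasawaS g, iwasawaT g⟩]; rfl,
    iwasawaS_iwasawa]
  simp only [Complex.add_re, Complex.ofReal_re]

/-- `t(n_σ g) = t(g)`. -/
theorem iwasawaT_unip_mul (σ : ℝ) (g : SU11) : iwasawaT (unip σ * g) = iwasawaT g := by
  conv_lhs => rw [eq_iwasawa_decomposition g]
  rw [show unip σ * (unip (iwasawaS g) * hyp (iwasawaT g) * rot (iwasawaK g)) =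
      iwasawa (⟨iwasawaS g, iwasawaT g⟩ + σ, iwasawaK g) from by
    rw [← mul_assoc, show unip σ * (unip (iwasawaS g) * hyp (iwasawaT g)) =
      borelCoordNA (⟨iwasawaS g, iwasawaT g⟩ + σ) from unip_mul_borelCoordNA σ ⟨iwasawaS g, iwasawaT g⟩]; rfl,
    iwasawaT_iwasawa]
  simp only [Complex.add_im, Complex.ofReal_im, add_zero]

/-- `t(a_τ g) = t(g) + τ`. -/
theorem iwasawaT_hyp_mul (τ : ℝ) (g : SU11) : iwasawaT (hyp τ * g) = iwasawaT g + τ := by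
  conv_lhs => rw [eq_iwasawa_decomposition g]
  rw [show hyp τ * (unip (iwasawaS g) * hyp (iwasawaT g) * rot (iwasawaK g)) =
      iwasawa (⟨Real.exp (2 * τ) * iwasawaS g, iwasawaT g + τ⟩, iwasawaK g) from by
    rw [← mul_assoc, show hyp τ * (unip (iwasawaS g) * hyp (iwasawaT g)) =
      borelCoordNA ⟨Real.exp (2 * τ) * iwasawaS g, iwasawaT g + τ⟩ from hyp_mul_borelCoordNA τ ⟨iwasawaS g, iwasawaT g⟩]; rfl,
    iwasawaT_iwasawa]

/-- `s(a_τ g) = e^{2τ} s(g)`. -/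
theorem iwasawaS_hyp_mul (τ : ℝ) (g : SU11) : iwasawaS (hyp τ * g) = Real.exp (2 * τ) * iwasawaS g := by
  conv_lhs => rw [eq_iwasawa_decomposition g]
  rw [show hyp τ * (unip (iwasawaS g) * hyp (iwasawaT g) * rot (iwasawaK g)) =
      iwasawa (⟨Real.exp (2 * τ) * iwasawaS g, iwasawaT g + τ⟩, iwasawaK g) from by
    rw [← mul_assoc, show hyp τ * (unip (iwasawaS g) * hyp (iwasawaT g)) =
      borelCoordNA ⟨Real.exp (2 * τ) * iwasawaS g, iwasawaT g + τ⟩ from hyp_mul_borelCoordNA τ ⟨iwasawaS g, iwasawaT g⟩]; rfl,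
    iwasawaS_iwasawa]

end Summit.Ventures.HodgeRepro2.T5SU11IwasawaProjection
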